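import Literature.AlgebraicGeometry.Resolution.PointBlowupObliqueNormalForm
import Literature.AlgebraicGeometry.Resolution.PointBlowupMohWitnessPrimePower
import Literature.AlgebraicGeometry.Resolution.HasseSchmidtLinearSubstitution
import Literature.AlgebraicGeometry.Resolution.AdditiveFormsStructure
import Literature.AlgebraicGeometry.Resolution.CentreBlowupResidueInequality
import HarnessLib

/-!
# Hauser–Perlega 2019, §3 Theorem: the obliquity condition (4) implies the logarithmic
  Hasse-derivative shape (8) — proved in the tree's hypersurface model

Topic: `Literature/AlgebraicGeometry/Resolution`. Source: H. Hauser, S. Perlega, *Characterizing the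
increase of the residual order under blowup in positive characteristic*, Publ. RIMS **55** (2019)
835–857 = arXiv:1906.09593 [HauserPerlega2019PRIMS], §3 Theorem, assertion (8) ("For `i ∈ T`, the
`p^ℓ`-th logarithmic Hasse derivatives of `F(x)` with respect to `x_i` are of the form
`x_i^{p^ℓ}·∂_{x_i^{p^ℓ}} F(x) = x^r·H_i(x)`, where `H_i` is a polynomial in `(x_j − t_j x_1)^{p^ℓ}` and
`x_k^{p^e}`") and its proof, §5 p. 12: "So assume that `ord_{Q_T} H_i < deg H_i` holds. Since `H_i` is a
`p^ℓ`-th power, this implies that `ord_{Q_T} H_i ≤ deg H_i − p^ℓ`. Plugging this into the chain of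
inequalities which we used to prove (9), we get that `ord_{Q_T} F̃_{c−q} ≤ ord_{Q_T} H_i + p^ℓ ≤ deg H_i
= u` … But this contradicts … (4)."

The companion file `PointBlowupObliqueNormalForm.lean` TYPES (4) as
`HauserPerlega2019.ObliqueOrderCondition q j t u F` (`u < ord^{mod q}` away from `y_j` of the sheared
polynomial) and (8) as `HauserPerlega2019.LogHasseOrderCondition p ℓ j t T u F`
(`u ≤ ord_{≠ j}(shear (∂_{y_i^{p^ℓ}} F))` for `i ∈ T`), and says: "the printed implications 'kangaroo
point ⇒ (5), (8), (9)' are NOT asserted". This file PROVES the implication **(4) ⇒ (8)** in that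
typed form, for every commutative ring `K` of prime characteristic `p`, every finite index type, every
polynomial `F` all of whose exponents are divisible by `p^ℓ` (the printed "`F` is a `p^ℓ`-th power",
exponentwise), every `ℓ < e`, every `u` divisible by `p^ℓ` (the printed `u = deg H_i`, a `p^ℓ`-th
power's degree) and EVERY index `i` (so every `T`):

* `HauserPerlega2019.le_orderAwayFrom_shear_hasseDeriv` — the paper's chain of inequalities for a
  Hasse derivative `D^{(β)}` of any multi-order `β` with `|β| = p^ℓ`:
  `ord_{≠ j}(shear (D^{(β)} F)) ≥ ord^{mod p^e}_{≠ j}(shear F) − p^ℓ ≥ u + 1 − p^ℓ`. Ingredients: the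
  chain rule for Hasse–Schmidt derivatives under the (invertible) shear (tree `hasseDeriv_lsubst`),
  Lucas' congruence `C(p^e a, m) ≡ 0 (mod p)` for `0 < m < p^e` (derivatives of order `p^ℓ < p^e` kill
  the `p^e`-th-power monomials, `hasseDeriv_eq_zero_of_isPthPowerExponent`), and "a derivative of
  order `|γ|` lowers `ord_{≠ j}` by at most `|γ|`" (`le_orderAwayFrom_hasseDeriv`);
* `HauserPerlega2019.logHasseOrderCondition_of_obliqueOrderCondition` — **(4) ⇒ (8)**: the rounding
  step "`ord` and `u` are multiples of `p^ℓ`, so `≥ u + 1 − p^ℓ` forces `≥ u`";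
* `…_of_le`, `HauserPerlega2019.logHasseOrderCondition_of_condition4` — the same at any smaller
  threshold divisible by `p^ℓ` (the printed `u` is `≤` the atlas' `residualDegree`), and at an edge
  `(j, b)` of the point-blow-up walk from `HauserPerlega2019.Condition4 (pᵉ) j b s`;
* private plumbing ([folklore]): `ord_{≠ j}` of sums / scalar multiples / derivatives, Lucas'
  `C(pᵉ a, m) ≡ 0 (mod p)` (`0 < m < pᵉ`), the shear as an invertible linear substitution, and
  "exponents divisible by `p^ℓ`" preserved by substitutions (Frobenius) and by `∂_{y_i^{p^ℓ}}`;
* `HauserPerlega2019.logHasseOrderCondition_of_shadeIncreases` (appended) — **jump ⇒ (8)** at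
  tangent-cone level over a field: composed with `PointBlowup.condition4_of_shadeIncreases`
  (`CentreBlowupResidueInequality.lean`, "increase ⇒ (4)");
* `HauserPerlega2019.residueInequality_of_pow_le_card` (appended) — Comment (f): (6) holds as soon
  as `b ≥ p^{ℓ+1}`; `HauserPerlega2019.residueInequality_iff_ne` — the printed equivalent form of (6),
  `Σ r̄ᵢ + ū ≠ b·p^{ℓ+1}`, under `p^{ℓ+1} ∣ Σ_{i∈T} rᵢ + u` (for the predicate
  `HauserPerlega2019.ResidueInequality` of `PointBlowupShade.lean`);
* `HauserPerlega2019.literalResidualDegree_le_and_dvd`, `logHasseOrderCondition_literal_of_shadeIncreases`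
  (appended) — the PRINTED threshold `u = deg In F − Σ_{i∈T} ord_{(y_i)} In F` is `≤` the atlas' one and
  divisible by `p^ℓ`, whence **(8) literally** (lost components `T`, printed `u`) from an increase of the shade;
* `HauserPerlega2019.hasseDeriv_single_eq_zero_of_forall_pow_dvd`, `hasseDeriv_initialForm_eq_zero_of_shadeIncreases`
  (appended) — assertion (7) in the printed DERIVATIVE form: `∂_{y_i^{p^k}} (In F) = 0` for `k < e` and every
  non-exceptional `y_i` after an increase (from the model's (7), `PointBlowupMohWitnessPrimePower.lean`);
* `HauserPerlega2019.logHasseOrderCondition_literal_of_isPthPowerLevel`, `sharpJumpBound_of_isPthPowerLevel`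
  (appended) — (8) and the `p^ℓ`-form of (9) (`SharpJumpBound`, via the tree's `shade_step_le_add_pow`) at
  the typed `p`-th power level `IsPthPowerLevel p e ℓ (In F)`;
* `PointBlowup.hasseDeriv_eq_hasseDeriv` — the model's coefficientwise Hasse derivative
  (`PointBlowupIFPUnit.lean`) IS the Taylor-coefficient Hasse–Schmidt derivative of
  `HasseSchmidtDerivatives.lean` (bridge used to state the result with the predicate's `PointBlowup.hasseDeriv`).

Scope (honest): this is the tangent-cone statement of the paper for the purely inseparable
hypersurface model in the SHEARED coordinates of `Condition4`; nothing is said about coefficient ideals of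
general ideals, and nothing here is a statement about resolution of singularities. AI-assisted
formalisation (cell `res-hironaka`, seat res-type-014, critic-side batch reading of the paper); the Lean
statements are what is certified.
-/

open MvPolynomial Finset
open scoped BigOperators

namespace Literature.AlgebraicGeometry.Resolution

open Literature.AlgebraicGeometry.Resolution.Hauser2010

namespace HauserPerlega2019

variable {σ : Type*} {K : Type*} [CommRing K]

/-! ## 1. `orderAwayFrom` bookkeeping -/

/-- `n ≤ ord_{≠ j} G` iff every monomial `y^d` of `G` has `|d| − d_j ≥ n`. [folklore] -/
private theorem le_orderAwayFrom_iff (j : σ) (G : MvPolynomial σ K) (n : ℕ) :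
    (n : ℕ∞) ≤ orderAwayFrom j G ↔ ∀ d ∈ G.support, n ≤ d.degree - d j := by
  unfold orderAwayFrom
  rw [Finset.le_inf_iff]
  refine forall₂_congr fun d _ => ?_
  exact_mod_cast Iff.rfl

/-- `ord_{≠ j}` of a sum is at least the smaller of the two orders. [folklore] -/
private theorem le_orderAwayFrom_add [DecidableEq σ] {j : σ} {n : ℕ} {G H : MvPolynomial σ K}
    (hG : (n : ℕ∞) ≤ orderAwayFrom j G) (hH : (n : ℕ∞) ≤ orderAwayFrom j H) :
    (n : ℕ∞) ≤ orderAwayFrom j (G + H) := by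
  rw [le_orderAwayFrom_iff] at hG hH ⊢
  intro d hd
  rcases Finset.mem_union.mp (support_add hd) with h | h
  exacts [hG d h, hH d h]

/-- `ord_{≠ j}` does not drop under scalar multiplication. [folklore] -/
private theorem le_orderAwayFrom_smul {j : σ} {n : ℕ} {G : MvPolynomial σ K} (c : K)
    (hG : (n : ℕ∞) ≤ orderAwayFrom j G) : (n : ℕ∞) ≤ orderAwayFrom j (c • G) := by
  rw [le_orderAwayFrom_iff] at hG ⊢
  intro d hd
  exact hG d (support_smul hd)

/-- `ord_{≠ j}` of a finite sum is at least the common lower bound of the summands. [folklore] -/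
private theorem le_orderAwayFrom_sum [DecidableEq σ] {ι : Type*} {j : σ} {n : ℕ} (s : Finset ι)
    (G : ι → MvPolynomial σ K) (h : ∀ x ∈ s, (n : ℕ∞) ≤ orderAwayFrom j (G x)) :
    (n : ℕ∞) ≤ orderAwayFrom j (∑ x ∈ s, G x) := by
  classical
  induction s using Finset.induction_on with
  | empty => simp [orderAwayFrom_zero]
  | insert a s ha ih =>
    rw [Finset.sum_insert ha]
    exact le_orderAwayFrom_add (h a (Finset.mem_insert_self _ _))
      (ih fun x hx => h x (Finset.mem_insert_of_mem hx))

/-- **A Hasse–Schmidt derivative of multi-order `γ` lowers `ord_{≠ j}` by at most `|γ|`** (monomialwise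
`y^d ↦ C·y^{d−γ}`); the printed step "`ord_{Q_T}(F + G^q) ≤ ord_{Q_T} ∂_{x_i^{p^k}}(F) + p^k`".
[cite: HauserPerlega2019PRIMS, §5 proof of (7)–(9), p. 12] -/
theorem le_orderAwayFrom_hasseDeriv [DecidableEq σ] {j : σ} {n : ℕ} {G : MvPolynomial σ K}
    (hG : (n : ℕ∞) ≤ orderAwayFrom j G) (γ : σ →₀ ℕ) :
    ((n - γ.degree : ℕ) : ℕ∞) ≤ orderAwayFrom j (hasseDeriv K γ G) := by
  rw [le_orderAwayFrom_iff] at hG ⊢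
  intro d hd
  have hc : coeff d (hasseDeriv K γ G) ≠ 0 := mem_support_iff.mp hd
  rw [coeff_hasseDeriv] at hc
  have hmem : γ + d ∈ G.support := by
    rw [mem_support_iff]
    intro h0
    exact hc (by rw [h0, mul_zero])
  have h1 := hG _ hmem
  rw [map_add, Finsupp.add_apply] at h1
  have h2 : γ j ≤ γ.degree := Finsupp.le_degree j γ
  have h3 : d j ≤ d.degree := Finsupp.le_degree j d
  omega

/-! ## 2. Lucas: derivatives of order `< pᵉ` kill the `pᵉ`-th-power monomials -/

/-- Lucas: `C(pᵉ·a, m) ≡ 0 (mod p)` for `0 < m < pᵉ`. [folklore] -/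
private theorem choose_prime_pow_mul_modEq_zero (p : ℕ) [hp : Fact p.Prime] :
    ∀ (e a m : ℕ), 0 < m → m < p ^ e → (p ^ e * a).choose m ≡ 0 [MOD p] := by
  intro e
  induction e with
  | zero => intro a m hm hme; rw [pow_zero] at hme; omega
  | succ e ih =>
    intro a m hm hme
    have h := Choose.choose_modEq_choose_mod_mul_choose_div_nat (n := p ^ (e + 1) * a) (k := m)
      (p := p)
    have h1 : p ^ (e + 1) * a % p = 0 := by
      rw [pow_succ, mul_comm (p ^ e) p, mul_assoc]; exact Nat.mul_mod_right _ _
    have h2 : p ^ (e + 1) * a / p = p ^ e * a := by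
      rw [pow_succ, mul_comm (p ^ e) p, mul_assoc]; exact Nat.mul_div_cancel_left _ hp.out.pos
    rw [h1, h2] at h
    refine h.trans ?_
    by_cases hmp : m % p = 0
    · have hkey := Nat.div_add_mod m p
      rw [hmp, add_zero] at hkey
      have hm' : 0 < m / p := by
        rcases Nat.eq_zero_or_pos (m / p) with h0 | h0
        · rw [h0, mul_zero] at hkey; omega
        · exact h0
      have hme' : m / p < p ^ e := by
        rw [Nat.div_lt_iff_lt_mul hp.out.pos]
        calc m < p ^ (e + 1) := hme
          _ = p ^ e * p := pow_succ p e
      rw [hmp, Nat.choose_zero_right, one_mul]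
      exact ih a (m / p) hm' hme'
    · rw [Nat.choose_eq_zero_of_lt (Nat.pos_of_ne_zero hmp), zero_mul]

/-- The monomials of `G − deletePthPowers q G` are the `q`-th-power monomials of `G`. [folklore] -/
private theorem isPthPowerExponent_of_mem_support_sub_deletePthPowers [DecidableEq σ] (q : ℕ)
    (G : MvPolynomial σ K) :
    ∀ d ∈ (G - deletePthPowers q G).support, IsPthPowerExponent q d := by
  intro d hd
  by_contra h
  have : coeff d (G - deletePthPowers q G) = 0 := by
    rw [coeff_sub, coeff_deletePthPowers, if_neg h, sub_self]
  exact (mem_support_iff.mp hd) this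

/-- **Hasse derivatives of order `p^ℓ`, `ℓ < e`, kill every polynomial made of `pᵉ`-th-power monomials**
("Notice that `∂_{x_i^{p^k}}(G^q) = 0`", p. 12). [cite: HauserPerlega2019PRIMS, §5 proof of (7)–(9), p. 12] -/
theorem hasseDeriv_eq_zero_of_isPthPowerExponent [DecidableEq σ] (p : ℕ) [hp : Fact p.Prime]
    [CharP K p] {e ℓ : ℕ} (hℓ : ℓ < e) {R : MvPolynomial σ K}
    (hR : ∀ d ∈ R.support, IsPthPowerExponent (p ^ e) d) {γ : σ →₀ ℕ} (hγ : γ.degree = p ^ ℓ) :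
    hasseDeriv K γ R = 0 := by
  ext d
  rw [coeff_hasseDeriv, coeff_zero]
  by_cases hmem : γ + d ∈ R.support
  · have hγ0 : γ ≠ 0 := by
      intro h0
      rw [h0, map_zero] at hγ
      exact (pow_pos hp.out.pos ℓ).ne' hγ.symm
    obtain ⟨i, hi⟩ := Finsupp.support_nonempty_iff.mpr hγ0
    have hγi : 0 < γ i := Nat.pos_of_ne_zero (Finsupp.mem_support_iff.mp hi)
    have hγi' : γ i < p ^ e :=
      lt_of_le_of_lt (hγ ▸ Finsupp.le_degree i γ) (Nat.pow_lt_pow_right hp.out.one_lt hℓ)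
    have hdiv : p ^ e ∣ (γ + d) i :=
      hR _ hmem i (Finsupp.mem_support_iff.mpr (by rw [Finsupp.add_apply]; omega))
    obtain ⟨a, ha⟩ := hdiv
    have hz : (((γ + d) i).choose (γ i) : K) = 0 := by
      rw [ha, CharP.cast_eq_zero_iff K p]
      exact Nat.modEq_zero_iff_dvd.mp (choose_prime_pow_mul_modEq_zero p e a (γ i) hγi hγi')
    rw [← Finset.mul_prod_erase _ _ hi, Nat.cast_mul, hz, zero_mul, zero_mul]
  · rw [notMem_support_iff.mp hmem, mul_zero]

/-! ## 3. The shear as a linear substitution; its inverse -/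

/-- The shear `y_i ↦ y_i + t_i y_j` (`i ≠ j`), `y_j ↦ y_j` is the linear substitution with matrix
`δ_{ik} + [i ≠ j] t_i δ_{kj}`. [folklore] -/
private theorem shear_eq_lsubst [Fintype σ] [DecidableEq σ] (j : σ) (t : σ → K) (P : MvPolynomial σ K) :
    shear j t P = lsubst K (fun i k => (if k = i then (1 : K) else 0) +
      (if i ≠ j ∧ k = j then t i else 0)) P := by
  unfold shear lsubst
  have hfun : (fun i => if i = j then X j else X i + C (t i) * X j : σ → MvPolynomial σ K) =
      lsubstFun K (fun i k => (if k = i then (1 : K) else 0) +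
        (if i ≠ j ∧ k = j then t i else 0)) := by
    funext i
    unfold lsubstFun
    simp only [map_add, add_mul, Finset.sum_add_distrib, apply_ite C, map_one, map_zero, ite_mul,
      one_mul, zero_mul, Finset.sum_ite_eq', Finset.mem_univ, if_true]
    by_cases hij : i = j
    · subst hij
      simp
    · simp [hij]
  rw [hfun]

/-- The shear with vector `−t` undoes the shear with vector `t`. [folklore] -/
private theorem shear_shear_neg [DecidableEq σ] (j : σ) (t : σ → K) (P : MvPolynomial σ K) :
    shear j t (shear j (-t) P) = P := by
  unfold shear
  rw [← AlgHom.comp_apply]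
  conv_rhs => rw [← AlgHom.id_apply (R := K) P]
  congr 1
  refine MvPolynomial.algHom_ext fun i => ?_
  by_cases hij : i = j
  · subst hij
    simp
  · simp only [AlgHom.comp_apply, AlgHom.id_apply, aeval_X, if_neg hij, map_add, map_mul, aeval_C,
      algebraMap_eq, Pi.neg_apply, map_neg, if_true]
    ring

/-- The shear with vector `t` undoes the shear with vector `−t`. [folklore] -/
private theorem shear_neg_shear [DecidableEq σ] (j : σ) (t : σ → K) (P : MvPolynomial σ K) :
    shear j (-t) (shear j t P) = P := by
  have h := shear_shear_neg j (-t) P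
  rwa [neg_neg] at h

/-- The shear is additive on finite sums. [folklore] -/
private theorem shear_sum [DecidableEq σ] {ι : Type*} (j : σ) (t : σ → K) (s : Finset ι)
    (G : ι → MvPolynomial σ K) : shear j t (∑ x ∈ s, G x) = ∑ x ∈ s, shear j t (G x) := by
  unfold shear
  rw [map_sum]

/-- The shear is `K`-linear. [folklore] -/
private theorem shear_smul [DecidableEq σ] (j : σ) (t : σ → K) (c : K) (G : MvPolynomial σ K) :
    shear j t (c • G) = c • shear j t G := by
  unfold shear
  exact map_smul _ c G

/-! ## 4. Exponent divisibility is preserved by the shear and by Hasse derivatives -/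

/-- In characteristic `p`, a substitution `y_i ↦ f_i` preserves "every exponent is divisible by `p^ℓ`"
(`f_i^{p^ℓ a} = (f_i^{p^ℓ})^a` and Frobenius on supports). [folklore] -/
private theorem forall_dvd_of_mem_support_aeval [DecidableEq σ] (p : ℕ) [hp : Fact p.Prime] [CharP K p]
    (ℓ : ℕ) (f : σ → MvPolynomial σ K) {F : MvPolynomial σ K}
    (hF : ∀ d ∈ F.support, ∀ k, p ^ ℓ ∣ d k) :
    ∀ d ∈ (aeval f F).support, ∀ k, p ^ ℓ ∣ d k := by
  classical
  rw [F.as_sum, map_sum]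
  refine PointBlowup.forall_support_sum _ _ fun s hs => ?_
  rw [aeval_monomial, algebraMap_eq, Finsupp.prod]
  refine PointBlowup.forall_support_mul (P := fun m => ∀ k, p ^ ℓ ∣ m k)
    (Q := fun m => ∀ k, p ^ ℓ ∣ m k) (fun a c ha hc k => ?_)
    (PointBlowup.forall_support_C (fun k => dvd_zero _) _) ?_
  · rw [Finsupp.add_apply]; exact dvd_add (ha k) (hc k)
  have key : ∀ x ∈ s.support, ∀ m ∈ (f x ^ s x).support,
      (fun (_ : ℕ) (m : σ →₀ ℕ) => ∀ k, p ^ ℓ ∣ m k) 0 m := by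
    intro x _
    obtain ⟨a, ha⟩ := hF s hs x
    rw [ha, pow_mul]
    have h1 := PointBlowup.forall_support_pow_char_pow p ℓ (f x)
    have h2 := PointBlowup.forall_support_pow (P := fun (_ : ℕ) (m : σ →₀ ℕ) => ∀ k, p ^ ℓ ∣ m k)
      (n := 0) (fun k => dvd_zero _) (fun _ _ a c ha hc k => by
        rw [Finsupp.add_apply]; exact dvd_add (ha k) (hc k)) h1 a
    simpa using h2
  have h3 := PointBlowup.forall_support_prod (P := fun (_ : ℕ) (m : σ →₀ ℕ) => ∀ k, p ^ ℓ ∣ m k)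
    (n := fun _ => 0) (fun k => dvd_zero _) (fun _ _ a c ha hc k => by
      rw [Finsupp.add_apply]; exact dvd_add (ha k) (hc k)) (s := s.support)
      (f := fun x => f x ^ s x) key
  simpa using h3

/-- In characteristic `p`, if every exponent of `F` is divisible by `p^ℓ` then so is every exponent of
its shear (`(y_i + t_i y_j)^{p^ℓ a} = (y_i^{p^ℓ} + t_i^{p^ℓ} y_j^{p^ℓ})^a`). [folklore] -/
private theorem forall_dvd_of_mem_support_shear [DecidableEq σ] (p : ℕ) [hp : Fact p.Prime] [CharP K p]
    (ℓ : ℕ) (j : σ) (t : σ → K) {F : MvPolynomial σ K}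
    (hF : ∀ d ∈ F.support, ∀ k, p ^ ℓ ∣ d k) :
    ∀ d ∈ (shear j t F).support, ∀ k, p ^ ℓ ∣ d k := by
  unfold shear
  exact forall_dvd_of_mem_support_aeval p ℓ _ hF

/-- If every exponent of `F` is divisible by `p^ℓ` then so is every exponent of `∂_{y_i^{p^ℓ}} F`.
[folklore] -/
private theorem forall_dvd_of_mem_support_hasseDeriv_single [DecidableEq σ] (p ℓ : ℕ) (i : σ)
    {F : MvPolynomial σ K} (hF : ∀ d ∈ F.support, ∀ k, p ^ ℓ ∣ d k) :
    ∀ d ∈ (hasseDeriv K (Finsupp.single i (p ^ ℓ)) F).support, ∀ k, p ^ ℓ ∣ d k := by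
  intro d hd k
  have hc : coeff d (hasseDeriv K (Finsupp.single i (p ^ ℓ)) F) ≠ 0 := mem_support_iff.mp hd
  rw [coeff_hasseDeriv] at hc
  have hmem : Finsupp.single i (p ^ ℓ) + d ∈ F.support := by
    rw [mem_support_iff]
    intro h0
    exact hc (by rw [h0, mul_zero])
  have h1 := hF _ hmem k
  rw [Finsupp.add_apply] at h1
  by_cases hki : k = i
  · subst hki
    rw [Finsupp.single_eq_same] at h1
    exact (Nat.dvd_add_right (dvd_refl _)).mp h1
  · rw [Finsupp.single_eq_of_ne hki, zero_add] at h1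
    exact h1

/-- Rounding: if every exponent of `H` is a multiple of `p^ℓ`, `p^ℓ ∣ u`, and `ord_{≠ j} H ≥ u + 1 − p^ℓ`,
then `ord_{≠ j} H ≥ u` ("Since `H_i` is a `p^ℓ`-th power, this implies that `ord_{Q_T} H_i ≤ deg H_i −
p^ℓ`", p. 12, contrapositive). [cite: HauserPerlega2019PRIMS, §5 proof of (8), p. 12] -/
theorem le_orderAwayFrom_of_forall_dvd {P : ℕ} {j : σ} {u : ℕ} (hu : P ∣ u)
    {H : MvPolynomial σ K} (hH : ∀ d ∈ H.support, ∀ k, P ∣ d k)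
    (h : ((u + 1 - P : ℕ) : ℕ∞) ≤ orderAwayFrom j H) : (u : ℕ∞) ≤ orderAwayFrom j H := by
  rw [le_orderAwayFrom_iff] at h ⊢
  intro d hd
  have h1 := h d hd
  have hdeg : P ∣ d.degree := by
    rw [Finsupp.degree_apply]
    exact Finset.dvd_sum fun k _ => hH d hd k
  have hv : P ∣ d.degree - d j := Nat.dvd_sub hdeg (hH d hd j)
  obtain ⟨a, ha⟩ := hu
  obtain ⟨b, hb⟩ := hv
  rw [hb] at h1 ⊢
  rw [ha] at h1 ⊢
  by_contra hlt
  push Not at hlt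
  have hba : b < a := Nat.lt_of_mul_lt_mul_left hlt
  have h3 : P * b + P ≤ P * a := by
    have := Nat.mul_le_mul_left P (Nat.succ_le_of_lt hba)
    rwa [Nat.mul_succ] at this
  generalize P * a = x at *
  generalize P * b = y at *
  omega

/-! ## 5. The chain of inequalities and (4) ⇒ (8) -/

/-- **The chain of inequalities of the proof of (8)/(9)** ([HP19 PRIMS] §5 p. 12: "`ord_{Q_T} F̃_{c−q}
= ord_{Q_T}(F + G^q) ≤ ord_{Q_T} ∂_{x_i^{p^k}}(F) + p^k`"), in the sheared coordinates of `Condition4`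
and for a Hasse–Schmidt derivative `D^{(β)}` of ANY multi-order `β` with `|β| = p^ℓ`, `ℓ < e`: if
`u < ord^{mod pᵉ}_{≠ j}(shear_t F)` then `ord_{≠ j}(shear_t (D^{(β)} F)) ≥ u + 1 − p^ℓ`. Proof: write
`F = shear_{−t} G`, `G = shear_t F = G₀ + R` with `G₀ = deletePthPowers (pᵉ) G`; by the chain rule
`shear_t (D^{(β)} F)` is a `K`-combination of the `D^{(γ)} G`, `|γ| = p^ℓ` (the coefficients are
coefficients of products of `|γ|` linear forms, homogeneous of degree `|γ|`); `D^{(γ)} R = 0` by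
Lucas; and `D^{(γ)}` lowers `ord_{≠ j}` by at most `p^ℓ`. [cite: HauserPerlega2019PRIMS, §5 proof of (7)–(9), p. 12] -/
theorem le_orderAwayFrom_shear_hasseDeriv [Fintype σ] [DecidableEq σ] (p : ℕ) [hp : Fact p.Prime]
    [CharP K p] {e ℓ : ℕ} (hℓ : ℓ < e) (j : σ) (t : σ → K) {u : ℕ} {F : MvPolynomial σ K}
    (h4 : (u : ℕ∞) < pOrderAwayFrom (p ^ e) j (shear j t F)) (β : σ →₀ ℕ)
    (hβ : β.degree = p ^ ℓ) :
    ((u + 1 - p ^ ℓ : ℕ) : ℕ∞) ≤ orderAwayFrom j (shear j t (hasseDeriv K β F)) := by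
  classical
  obtain ⟨a, ha⟩ : ∃ a : σ → σ → K, a = fun i k => (if k = i then (1 : K) else 0) +
      (if i ≠ j ∧ k = j then (-t) i else 0) := ⟨_, rfl⟩
  have hF : F = lsubst K a (shear j t F) := by
    rw [ha, ← shear_eq_lsubst, shear_neg_shear]
  have hchain := hasseDeriv_lsubst K a β (shear j t F)
  rw [← hF] at hchain
  -- `shear_t (D^β F) = Σ_γ c_γ • D^γ (shear_t F)`
  have hshear : shear j t (hasseDeriv K β F) =
      ∑ γ ∈ (taylor K (shear j t F)).support,
        coeff β (γ.prod fun i k => lsubstFun K a i ^ k) • hasseDeriv K γ (shear j t F) := by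
    rw [hchain, shear_sum]
    refine Finset.sum_congr rfl fun γ _ => ?_
    rw [shear_smul, ha, ← shear_eq_lsubst, shear_shear_neg]
  rw [hshear]
  refine le_orderAwayFrom_sum _ _ fun γ _ => ?_
  by_cases hc : coeff β (γ.prod fun i k => lsubstFun K a i ^ k) = 0
  · rw [hc, zero_smul, orderAwayFrom_zero]; exact le_top
  -- the coefficient is that of a product of `|γ|` linear forms: `|γ| = |β| = p^ℓ`
  have hhom : (γ.prod fun i k => lsubstFun K a i ^ k).IsHomogeneous γ.degree := by
    rw [Finsupp.prod, Finsupp.degree_apply]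
    have := IsHomogeneous.prod γ.support (fun i => lsubstFun K a i ^ γ i) (fun i => 1 * γ i)
      (fun i _ => (isHomogeneous_lsubstFun K a i).pow (γ i))
    simpa using this
  have hγ : γ.degree = p ^ ℓ := by
    by_contra hne
    exact hc (hhom.coeff_eq_zero (by rw [hβ]; exact Ne.symm hne))
  refine le_orderAwayFrom_smul _ ?_
  -- `D^γ G = D^γ G₀` with `G₀ = deletePthPowers (p^e) G`
  have hsplit : shear j t F = deletePthPowers (p ^ e) (shear j t F) +
      (shear j t F - deletePthPowers (p ^ e) (shear j t F)) := by ring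
  have hkill : hasseDeriv K γ (shear j t F - deletePthPowers (p ^ e) (shear j t F)) = 0 :=
    hasseDeriv_eq_zero_of_isPthPowerExponent p hℓ
      (isPthPowerExponent_of_mem_support_sub_deletePthPowers (p ^ e) (shear j t F)) hγ
  rw [hsplit, map_add, hkill, add_zero]
  -- `ord_{≠ j} G₀ ≥ u + 1`, and `D^γ` costs at most `p^ℓ`
  have h0 : ((u + 1 : ℕ) : ℕ∞) ≤ orderAwayFrom j (deletePthPowers (p ^ e) (shear j t F)) := by
    have := (ENat.add_one_le_iff (ENat.coe_ne_top u)).mpr h4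
    unfold pOrderAwayFrom at this
    exact_mod_cast this
  have := le_orderAwayFrom_hasseDeriv h0 γ
  rwa [hγ] at this

/-- The model's coefficientwise Hasse derivative (`PointBlowup.hasseDeriv`, `PointBlowupIFPUnit.lean`) is
the Taylor-coefficient Hasse–Schmidt derivative `D^{(J)}` of `HasseSchmidtDerivatives.lean`: both are the
operator `c·y^d ↦ (∏_i C(d_i, J_i))·c·y^{d−J}` of EGA IV (16.11.2.1) / Kawanoue's `∂_{X^J}(X^I) = C(I,J) X^{I−J}`.
[cite: EGAIV4, Thm. 16.11.2 (16.11.2.1)] [cite: Kawanoue2007, Lemma 1.2.1.2 (1)(i)] -/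
theorem _root_.Literature.AlgebraicGeometry.Resolution.PointBlowup.hasseDeriv_eq_hasseDeriv
    [DecidableEq σ] (J : σ →₀ ℕ) (F : MvPolynomial σ K) :
    PointBlowup.hasseDeriv J F = hasseDeriv K J F := by
  classical
  unfold PointBlowup.hasseDeriv
  conv_rhs => rw [F.as_sum, map_sum]
  refine Finset.sum_congr rfl fun d _ => ?_
  rw [hasseDeriv_monomial, ← map_natCast C, C_mul_monomial]

/-- **[HauserPerlega2019PRIMS] §3 Theorem, (4) ⇒ (8), in the tree's model.** Over a commutative ring of
prime characteristic `p`, let `ℓ < e`, let every exponent of `F` be divisible by `p^ℓ` ("`F` is a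
`p^ℓ`-th power"), and let `p^ℓ ∣ u` (the printed `u = deg H_i`). If the obliquity condition (4) holds at
the shear vector `t` with threshold `u` — `ObliqueOrderCondition (pᵉ) j t u F` — then the logarithmic
Hasse-derivative shape (8) holds for EVERY index set `T`: `LogHasseOrderCondition p ℓ j t T u F`, i.e.
`ord_{≠ j}(shear_t (∂_{y_i^{p^ℓ}} F)) ≥ u` for all `i ∈ T` (printed: "`H_i` is a polynomial in
`(x_j − t_j x_1)^{p^ℓ}` and `x_k^{pᵉ}` … equivalent to the equality `ord_{Q_T} H_i = deg H_i`").
[cite: HauserPerlega2019PRIMS, §3 Theorem (8); §5 proof of (8), p. 12] -/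
theorem logHasseOrderCondition_of_obliqueOrderCondition [Fintype σ] [DecidableEq σ] (p : ℕ)
    [hp : Fact p.Prime] [CharP K p] {e ℓ : ℕ} (hℓ : ℓ < e) (j : σ) (t : σ → K) (T : Finset σ)
    {u : ℕ} (hu : p ^ ℓ ∣ u) {F : MvPolynomial σ K} (hF : ∀ d ∈ F.support, ∀ k, p ^ ℓ ∣ d k)
    (h4 : ObliqueOrderCondition (p ^ e) j t u F) : LogHasseOrderCondition p ℓ j t T u F := by
  intro i _
  rw [PointBlowup.hasseDeriv_eq_hasseDeriv]
  refine le_orderAwayFrom_of_forall_dvd hu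
    (forall_dvd_of_mem_support_shear p ℓ j t (forall_dvd_of_mem_support_hasseDeriv_single p ℓ i hF)) ?_
  exact le_orderAwayFrom_shear_hasseDeriv p hℓ j t h4 _ (Finsupp.degree_single _ _)

/-- (4) ⇒ (8) with a smaller threshold: condition (4) is antitone and (8) monotone in `u`, so (4) at the
atlas' `u = residualDegree` (which is `≥` the printed `u`, cf. `literalResidualDegree`) gives (8) at every
`u' ≤ u` divisible by `p^ℓ` — in particular at the printed one.
[cite: HauserPerlega2019PRIMS, §3 Theorem (8); §5 proof of (8), p. 12] -/
theorem logHasseOrderCondition_of_obliqueOrderCondition_of_le [Fintype σ] [DecidableEq σ] (p : ℕ)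
    [hp : Fact p.Prime] [CharP K p] {e ℓ : ℕ} (hℓ : ℓ < e) (j : σ) (t : σ → K) (T : Finset σ)
    {u u' : ℕ} (hu' : u' ≤ u) (hdiv : p ^ ℓ ∣ u') {F : MvPolynomial σ K}
    (hF : ∀ d ∈ F.support, ∀ k, p ^ ℓ ∣ d k) (h4 : ObliqueOrderCondition (p ^ e) j t u F) :
    LogHasseOrderCondition p ℓ j t T u' F := by
  refine logHasseOrderCondition_of_obliqueOrderCondition p hℓ j t T hdiv hF ?_
  unfold ObliqueOrderCondition at h4 ⊢
  exact lt_of_le_of_lt (by exact_mod_cast hu') h4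

/-- **At a point of the point-blow-up walk**: if condition (4) holds at the edge `(j, b)` of the state `s`
(`HauserPerlega2019.Condition4 (pᵉ) j b s`, e.g. by `PointBlowup.condition4_of_shadeIncreases` whenever
the shade increases there) and the initial form of the residual polynomial has all its exponents
divisible by `p^ℓ`, `ℓ < e`, then the log-Hasse shape (8) holds for the initial form at every threshold
`u' ≤ residualDegree j b s` divisible by `p^ℓ` and every index set `T` (e.g. the lost components).
[cite: HauserPerlega2019PRIMS, §3 Theorem (4) ⇒ (8)] -/
theorem logHasseOrderCondition_of_condition4 [Fintype σ] [DecidableEq σ] [DecidableEq K] (p : ℕ)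
    [hp : Fact p.Prime] [CharP K p] {e ℓ : ℕ} (hℓ : ℓ < e) (j : σ) (b : σ → K) (T : Finset σ)
    (s : PointBlowup.State σ K) {u' : ℕ} (hu' : u' ≤ residualDegree j b s) (hdiv : p ^ ℓ ∣ u')
    (hF : ∀ d ∈ (initialForm s.F).support, ∀ k, p ^ ℓ ∣ d k) (h4 : Condition4 (p ^ e) j b s) :
    LogHasseOrderCondition p ℓ j b T u' (initialForm s.F) :=
  logHasseOrderCondition_of_obliqueOrderCondition_of_le p hℓ j b T hu' hdiv hF h4

/-! ## 6. Jump ⇒ (8) (appended): composing with "increase ⇒ (4)" -/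

/-- **Jump ⇒ (8) at tangent-cone level.** Over a field of characteristic `p`: if the shade INCREASES at
the point `b` of the `y_j`-chart of the point blow-up (`ord₀ F = o ≥ pᵉ`, `y^r ∣ F` monomialwise), then
condition (4) holds there (`PointBlowup.condition4_of_shadeIncreases`, "increase ⇒ (4)"), hence — for an
initial form all of whose exponents are divisible by `p^ℓ`, `ℓ < e` ("`F` is a `p^ℓ`-th power") — the
log-Hasse shape (8) holds at every threshold `u' ≤ residualDegree j b s` divisible by `p^ℓ` and for every
index set `T`. The printed theorem asserts this for the residual order of a general ideal; here it is the
purely inseparable hypersurface model of `PointBlowupShade.lean`.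
[cite: HauserPerlega2019PRIMS, §3 Theorem (8)] -/
theorem logHasseOrderCondition_of_shadeIncreases {L : Type*} [Field L] [Fintype σ] [DecidableEq σ]
    [DecidableEq L] (p : ℕ) [hp : Fact p.Prime] [CharP L p] {e ℓ : ℕ} (hℓ : ℓ < e) (j : σ)
    (b : σ → L) (hbj : b j = 0) (T : Finset σ) (s : PointBlowup.State σ L) {o : ℕ}
    (ho : ordZero s.F = o) (hqo : p ^ e ≤ o) (hr : ∀ d ∈ s.F.support, s.r ≤ d)
    (hinc : PointBlowup.ShadeIncreases (p ^ e) j b s) {u' : ℕ} (hu' : u' ≤ residualDegree j b s)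
    (hdiv : p ^ ℓ ∣ u') (hF : ∀ d ∈ (initialForm s.F).support, ∀ k, p ^ ℓ ∣ d k) :
    LogHasseOrderCondition p ℓ j b T u' (initialForm s.F) :=
  logHasseOrderCondition_of_condition4 p hℓ j b T s hu' hdiv hF
    (PointBlowup.condition4_of_shadeIncreases (p ^ e) j b hbj s ho hqo hr hinc)

/-! ## 7. Assertion (6): Comment (f) and the printed equivalent form (appended) -/

/-- The sum of the residues modulo `P` over `T` is carried by the `b` indices with `P ∤ rᵢ`, each
contributing at most `P − 1`. [folklore] -/
private theorem sum_mod_le_card_mul {ι : Type*} (P : ℕ) (hP : 0 < P) (T : Finset ι) (r : ι → ℕ) :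
    ∑ i ∈ T, r i % P ≤ (T.filter fun i => ¬ P ∣ r i).card * (P - 1) := by
  classical
  have hsum : ∑ i ∈ T, r i % P = ∑ i ∈ T.filter (fun i => ¬ P ∣ r i), r i % P := by
    rw [Finset.sum_filter]
    refine Finset.sum_congr rfl fun i _ => ?_
    split_ifs with h
    · exact Nat.mod_eq_zero_of_dvd h
    · rfl
  rw [hsum]
  calc ∑ i ∈ T.filter (fun i => ¬ P ∣ r i), r i % P
      ≤ ∑ _i ∈ T.filter (fun i => ¬ P ∣ r i), (P - 1) :=
        Finset.sum_le_sum fun i _ => Nat.le_sub_one_of_lt (Nat.mod_lt _ hP)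
    _ = (T.filter fun i => ¬ P ∣ r i).card * (P - 1) := by rw [Finset.sum_const, smul_eq_mul]

/-- **Comment (f).** "For a fixed prime number `p`, the arithmetic inequality for the residues of the
multiplicities `rᵢ` in assertion (6) of the theorem always holds when `T` contains sufficiently many
indices `i` with `rᵢ ≢ 0 mod p^{ℓ+1}`" — quantitatively: as soon as their number `b` is `≥ p^{ℓ+1}`
(each residue is `≤ p^{ℓ+1} − 1`, so `Σ r̄ᵢ ≤ b·(p^{ℓ+1} − 1) ≤ (b − 1)·p^{ℓ+1}`).
[cite: HauserPerlega2019PRIMS, §3 Comments (f)] -/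
theorem residueInequality_of_pow_le_card {p : ℕ} (hp : 0 < p) (ℓ : ℕ) (T : Finset σ) (r : σ → ℕ)
    (hb : p ^ (ℓ + 1) ≤ (T.filter fun i => ¬ p ^ (ℓ + 1) ∣ r i).card) :
    ResidueInequality p ℓ T r := by
  unfold ResidueInequality
  have hP0 : 0 < p ^ (ℓ + 1) := pow_pos hp _
  have h1 := sum_mod_le_card_mul (p ^ (ℓ + 1)) hP0 T r
  generalize hP : p ^ (ℓ + 1) = P at *
  generalize hbdef : (T.filter fun i => ¬ P ∣ r i).card = b at *
  generalize hS : ∑ i ∈ T, r i % P = S at *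
  have h2 : S + b ≤ b * P :=
    calc S + b ≤ b * (P - 1) + b := Nat.add_le_add_right h1 _
      _ = b * P := by rw [Nat.mul_sub_one, Nat.sub_add_cancel (Nat.le_mul_of_pos_right _ hP0)]
  have h3 : (S : ℤ) + b ≤ (b : ℤ) * P := by exact_mod_cast h2
  have h4 : (P : ℤ) ≤ b := by exact_mod_cast hb
  have h5 : ((b : ℤ) - 1) * P = b * P - P := by ring
  rw [h5]
  linarith

/-- **Assertion (6), the printed equivalent form.** "Equivalently, one has
`Σ_{i∈T} r̄ᵢ + v̄ ≠ b·p^{ℓ+1}`" — where, by the proof (§5 p. 12: "By definition of `v`, we have that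
`deg F = Σ_{i∈T} rᵢ + v`"), `v = deg F − Σ_{i∈T} rᵢ = u = deg G`, and "`deg F` is a multiple of `pᵉ`. Hence,
it is also a multiple of `p^{ℓ+1}`": under `p^{ℓ+1} ∣ Σ_{i∈T} rᵢ + u`, the residue inequality (6) holds iff
`Σ_{i∈T} r̄ᵢ + ū ≠ b·p^{ℓ+1}` (bars = residues modulo `p^{ℓ+1}`, `b` the number of `i ∈ T` with
`p^{ℓ+1} ∤ rᵢ`). Proof here: `Σ r̄ᵢ + ū` is a multiple of `p^{ℓ+1}`, at most `b(p^{ℓ+1} − 1) + (p^{ℓ+1} − 1)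
< (b+1)p^{ℓ+1}`, and it exceeds `(b−1)p^{ℓ+1}` exactly when (6) fails — so (6) fails iff it equals
`b·p^{ℓ+1}`.
[cite: HauserPerlega2019PRIMS, §3 Theorem (6) (equivalent form); §5 proof of (6), p. 12] -/
theorem residueInequality_iff_ne {p : ℕ} (hp : 0 < p) (ℓ : ℕ) (T : Finset σ) (r : σ → ℕ) (u : ℕ)
    (hdeg : p ^ (ℓ + 1) ∣ ∑ i ∈ T, r i + u) :
    ResidueInequality p ℓ T r ↔
      ∑ i ∈ T, r i % p ^ (ℓ + 1) + u % p ^ (ℓ + 1) ≠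
        (T.filter fun i => ¬ p ^ (ℓ + 1) ∣ r i).card * p ^ (ℓ + 1) := by
  unfold ResidueInequality
  have hP0 : 0 < p ^ (ℓ + 1) := pow_pos hp _
  have hS := sum_mod_le_card_mul (p ^ (ℓ + 1)) hP0 T r
  have hu := Nat.mod_lt u hP0
  have hdvd : p ^ (ℓ + 1) ∣ ∑ i ∈ T, r i % p ^ (ℓ + 1) + u % p ^ (ℓ + 1) := by
    apply Nat.dvd_of_mod_eq_zero
    calc (∑ i ∈ T, r i % p ^ (ℓ + 1) + u % p ^ (ℓ + 1)) % p ^ (ℓ + 1)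
        = ((∑ i ∈ T, r i % p ^ (ℓ + 1)) % p ^ (ℓ + 1) + u % p ^ (ℓ + 1) % p ^ (ℓ + 1)) %
            p ^ (ℓ + 1) := Nat.add_mod _ _ _
      _ = ((∑ i ∈ T, r i) % p ^ (ℓ + 1) + u % p ^ (ℓ + 1)) % p ^ (ℓ + 1) := by
            rw [← Finset.sum_nat_mod, Nat.mod_mod]
      _ = (∑ i ∈ T, r i + u) % p ^ (ℓ + 1) := (Nat.add_mod _ _ _).symm
      _ = 0 := Nat.mod_eq_zero_of_dvd hdeg
  generalize hP : p ^ (ℓ + 1) = P at *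
  generalize hbdef : (T.filter fun i => ¬ P ∣ r i).card = b at *
  generalize hSdef : ∑ i ∈ T, r i % P = S at *
  generalize hw : u % P = w at *
  obtain ⟨k, hk⟩ := hdvd
  have hPz : (0 : ℤ) < P := by exact_mod_cast hP0
  have hwz : (w : ℤ) < P := by exact_mod_cast hu
  have hSz : (S : ℤ) ≤ b * P - b := by
    have h2 : S + b ≤ b * P :=
      calc S + b ≤ b * (P - 1) + b := Nat.add_le_add_right hS _
        _ = b * P := by rw [Nat.mul_sub_one, Nat.sub_add_cancel (Nat.le_mul_of_pos_right _ hP0)]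
    have h3 : (S : ℤ) + b ≤ (b : ℤ) * P := by exact_mod_cast h2
    linarith
  have hkz : (S : ℤ) + w = P * k := by exact_mod_cast hk
  have h5 : ((b : ℤ) - 1) * P = b * P - P := by ring
  rw [h5]
  constructor
  · intro h6 heq
    have heqz : (S : ℤ) + w = b * P := by exact_mod_cast heq
    linarith
  · intro hne
    by_contra h6
    push Not at h6
    apply hne
    -- `S + w = P k` lies in the window `((b−1)P, (b+1)P)`, so `k = b`
    have hk1 : (b : ℤ) - 1 < k := by
      by_contra hcon
      push Not at hcon
      have := mul_le_mul_of_nonneg_left hcon hPz.le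
      have h0 : (0 : ℤ) ≤ w := by exact_mod_cast Nat.zero_le w
      linarith
    have hk2 : (k : ℤ) < b + 1 := by
      by_contra hcon
      push Not at hcon
      have := mul_le_mul_of_nonneg_left hcon hPz.le
      linarith
    have hkb : k = b := by
      have : (k : ℤ) = b := by omega
      exact_mod_cast this
    rw [hk, hkb, mul_comm]

/-! ## 8. The printed threshold: `u = deg F − Σ_{i∈T} ord_{(xᵢ)} F` (appended) -/

/-- For a nonzero `P`, the `y_i`-adic order `ord_{(y_i)} P` is attained: it is `d i` for some monomial
`y^d` of `P`, and it is `≤ d' i` for every monomial `y^{d'}`. [folklore] -/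
private theorem exists_divisorOrder_eq {i : σ} {P : MvPolynomial σ K} (hP : P ≠ 0) :
    ∃ d ∈ P.support, PointBlowup.divisorOrder i P = (d i : ℕ∞) := by
  unfold PointBlowup.divisorOrder
  obtain ⟨d, hd, h⟩ := Finset.exists_mem_eq_inf P.support (support_nonempty.mpr hP)
    (fun d => (d i : ℕ∞))
  exact ⟨d, hd, h⟩

/-- `ord_{(y_i)} P ≤ d i` for every monomial `y^d` of `P`. [folklore] -/
private theorem divisorOrder_le_apply {i : σ} {P : MvPolynomial σ K} {d : σ →₀ ℕ}
    (hd : d ∈ P.support) : PointBlowup.divisorOrder i P ≤ (d i : ℕ∞) := by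
  unfold PointBlowup.divisorOrder
  exact Finset.inf_le hd

/-- **The printed `u` is at most the atlas' `u`, and is a multiple of `p^ℓ`.** For a state `s` with
`ord₀ F = o` and `y^r ∣ F` monomialwise, the initial form `In F` is nonzero homogeneous of degree `o`,
`ord_{(y_i)} In F ≥ r_i`, so the printed `u = deg In F − Σ_{i∈T} ord_{(y_i)} In F`
(`literalResidualDegree T (In F)`) is `≤ o − Σ_{i∈T} r_i` (`residualDegree`, `T` the lost components); and
if every exponent of `In F` is divisible by `p^ℓ` then so is the printed `u` ("`G` a homogeneous polynomial
of degree `u`", `G` a `p^ℓ`-th power with `F`). [cite: HauserPerlega2019PRIMS, §3 Theorem (4) (definition of u)] -/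
theorem literalResidualDegree_le_and_dvd [Fintype σ] [DecidableEq σ] [DecidableEq K] (p ℓ : ℕ) (j : σ)
    (b : σ → K) (s : PointBlowup.State σ K) {o : ℕ} (ho : ordZero s.F = o)
    (hr : ∀ d ∈ s.F.support, s.r ≤ d) (hF : ∀ d ∈ (initialForm s.F).support, ∀ k, p ^ ℓ ∣ d k) :
    literalResidualDegree (PointBlowup.lostComponents j b) (initialForm s.F) ≤ residualDegree j b s ∧
      p ^ ℓ ∣ literalResidualDegree (PointBlowup.lostComponents j b) (initialForm s.F) := by
  classical
  unfold initialForm at hF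
  unfold literalResidualDegree residualDegree initialForm
  rw [ho, ENat.toNat_coe] at hF ⊢
  set P : MvPolynomial σ K := homogeneousComponent o s.F with hPdef
  obtain ⟨⟨d₀, hd₀, hd₀deg⟩, -⟩ := (ordZero_eq_nat_iff _ _).mp ho
  have hPd₀ : coeff d₀ P ≠ 0 := by
    rw [hPdef, coeff_homogeneousComponent, if_pos hd₀deg]; exact hd₀
  have hP0 : P ≠ 0 := fun h => hPd₀ (by rw [h, coeff_zero])
  have hPhom : P.IsHomogeneous o := homogeneousComponent_isHomogeneous o s.F
  have hdeg : P.totalDegree = o := hPhom.totalDegree hP0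
  -- monomials of `P` are monomials of `F` of degree `o`
  have hsuppF : ∀ d ∈ P.support, d ∈ s.F.support ∧ d.degree = o := by
    intro d hd
    rw [mem_support_iff, hPdef, coeff_homogeneousComponent] at hd
    by_cases h : d.degree = o
    · rw [if_pos h] at hd; exact ⟨mem_support_iff.mpr hd, h⟩
    · exact absurd (if_neg h) hd
  -- `r_i ≤ ord_{(y_i)} P`, finite
  have hri : ∀ i, s.r i ≤ (PointBlowup.divisorOrder i P).toNat ∧
      p ^ ℓ ∣ (PointBlowup.divisorOrder i P).toNat := by
    intro i
    obtain ⟨d, hd, hdi⟩ := exists_divisorOrder_eq (i := i) hP0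
    rw [hdi, ENat.toNat_coe]
    exact ⟨Finsupp.le_def.mp (hr d (hsuppF d hd).1) i, hF d hd i⟩
  rw [hdeg]
  refine ⟨Nat.sub_le_sub_left (Finset.sum_le_sum fun i _ => (hri i).1) _, ?_⟩
  refine Nat.dvd_sub ?_ (Finset.dvd_sum fun i _ => (hri i).2)
  -- `p^ℓ ∣ o = |d|` for a monomial `d` of `P`
  have hd₀P : d₀ ∈ P.support := mem_support_iff.mpr hPd₀
  rw [← hd₀deg, Finsupp.degree_apply]
  exact Finset.dvd_sum fun k _ => hF d₀ hd₀P k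

/-- **[HauserPerlega2019PRIMS] §3 Theorem (8), literally, at tangent-cone level.** Over a field of
characteristic `p`: if the shade increases at the point `b` of the `y_j`-chart (`ord₀ F = o ≥ pᵉ`, `y^r ∣ F`),
and the initial form `In F` has all exponents divisible by `p^ℓ`, `ℓ < e`, then for `T` = the LOST
components and the PRINTED threshold `u = deg In F − Σ_{i∈T} ord_{(y_i)} In F`:
`ord_{≠ j}(shear_b(∂_{y_i^{p^ℓ}} In F)) ≥ u` for every `i ∈ T` — "`x_i^{p^ℓ}·∂_{x_i^{p^ℓ}} F = x^r·H_i` with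
`H_i` a polynomial in `(x_j − t_j x_1)^{p^ℓ}` and `x_k^{pᵉ}`" in the order form of the proof (p. 12).
[cite: HauserPerlega2019PRIMS, §3 Theorem (8); §5 proof of (8), p. 12] -/
theorem logHasseOrderCondition_literal_of_shadeIncreases {L : Type*} [Field L] [Fintype σ]
    [DecidableEq σ] [DecidableEq L] (p : ℕ) [hp : Fact p.Prime] [CharP L p] {e ℓ : ℕ} (hℓ : ℓ < e)
    (j : σ) (b : σ → L) (hbj : b j = 0) (s : PointBlowup.State σ L) {o : ℕ} (ho : ordZero s.F = o)
    (hqo : p ^ e ≤ o) (hr : ∀ d ∈ s.F.support, s.r ≤ d) (hinc : PointBlowup.ShadeIncreases (p ^ e) j b s)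
    (hF : ∀ d ∈ (initialForm s.F).support, ∀ k, p ^ ℓ ∣ d k) :
    LogHasseOrderCondition p ℓ j b (PointBlowup.lostComponents j b)
      (literalResidualDegree (PointBlowup.lostComponents j b) (initialForm s.F)) (initialForm s.F) := by
  obtain ⟨hle, hdvd⟩ := literalResidualDegree_le_and_dvd p ℓ j b s ho hr hF
  exact logHasseOrderCondition_of_shadeIncreases p hℓ j b hbj _ s ho hqo hr hinc hle hdvd hF

/-! ## 9. Assertion (7) in the printed derivative form (appended) -/

/-- **Derivatives of order `p^k`, `k < e`, in a `pᵉ`-inert variable vanish**: if every exponent of `y_i`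
in `F` is divisible by `pᵉ` then `∂_{y_i^{p^k}} F = 0` for `k < e` (`C(pᵉ a, p^k) ≡ 0 (mod p)`). The printed
step "`∂_{x_i^{p^k}}(F) = 0` holds for all indices `i ∉ T` and all `k ≥ 0` with `p^k < q`. Thus, the variables
`x_i` with `i ∉ T` only appear as `q`-th powers in `F`" read backwards.
[cite: HauserPerlega2019PRIMS, §5 proof of (7), p. 12] -/
theorem hasseDeriv_single_eq_zero_of_forall_pow_dvd [DecidableEq σ] (p : ℕ) [hp : Fact p.Prime]
    [CharP K p] {e k : ℕ} (hk : k < e) (i : σ) {F : MvPolynomial σ K}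
    (hF : ∀ d ∈ F.support, p ^ e ∣ d i) :
    hasseDeriv K (Finsupp.single i (p ^ k)) F = 0 := by
  ext d
  rw [coeff_hasseDeriv, coeff_zero]
  by_cases hmem : Finsupp.single i (p ^ k) + d ∈ F.support
  · have hpk : p ^ k ≠ 0 := (pow_pos hp.out.pos k).ne'
    rw [Finsupp.support_single i hpk, Finset.prod_singleton, Finsupp.single_eq_same,
      natCast_choose_prime_pow_eq_zero_of_pow_dvd p K hk (hF _ hmem), zero_mul]
  · rw [notMem_support_iff.mp hmem, mul_zero]

/-- **[HauserPerlega2019PRIMS] §3 Theorem (7), derivative form, at tangent-cone level.** Over a field of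
characteristic `p`: if the shade increases at the point `b` of the `y_j`-chart (`ord₀ F = o ≥ pᵉ`, `y^r ∣ F`),
then for every NON-EXCEPTIONAL variable `y_i` (`r_i = 0`; the chart variable included) and every `k < e`,
`∂_{y_i^{p^k}} (In F) = 0` — the model's (7) (`PointBlowup.pow_dvd_apply_of_shadeIncreases_of_nonexceptional`:
`pᵉ` divides the `y_i`-exponents of the initial monomials) in the form the paper proves it ("the variables
`x_j` appear only as `pᵉ`-th powers in `F(x)`" ⟸ "`∂_{x_i^{p^k}}(F) = 0` … for all `k` with `p^k < q`").
[cite: HauserPerlega2019PRIMS, §3 Theorem (7); §5 proof of (7), p. 12] -/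
theorem hasseDeriv_initialForm_eq_zero_of_shadeIncreases {L : Type*} [Field L] [Fintype σ]
    [DecidableEq σ] [DecidableEq L] (p : ℕ) [hp : Fact p.Prime] [CharP L p] {e k : ℕ} (hk : k < e)
    (j : σ) (b : σ → L) (hbj : b j = 0) (s : PointBlowup.State σ L) {o : ℕ} (ho : ordZero s.F = o)
    (hqo : p ^ e ≤ o) (hr : ∀ d ∈ s.F.support, s.r ≤ d) (hinc : PointBlowup.ShadeIncreases (p ^ e) j b s)
    {i : σ} (hri : s.r i = 0) :
    hasseDeriv L (Finsupp.single i (p ^ k)) (initialForm s.F) = 0 := by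
  classical
  refine hasseDeriv_single_eq_zero_of_forall_pow_dvd p hk i fun d hd => ?_
  unfold initialForm at hd
  rw [ho, ENat.toNat_coe, mem_support_iff, coeff_homogeneousComponent] at hd
  by_cases h : d.degree = o
  · rw [if_pos h] at hd
    exact PointBlowup.pow_dvd_apply_of_shadeIncreases_of_nonexceptional p j b hbj s ho hqo hr hinc hri
      (mem_support_iff.mpr hd) h
  · exact absurd (if_neg h) hd

/-! ## 10. With the typed `p`-th power LEVEL `ℓ` of the initial form (appended) -/

/-- **(8) literally, with `ℓ` THE `p`-th power level of the initial form** (`IsPthPowerLevel p e ℓ (In F)`: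
"`ℓ < e` the largest integer so that `F` is a `p^ℓ`-th power", typed in `PointBlowupObliqueNormalForm.lean`):
an increase of the shade at the point `b` of the `y_j`-chart forces, for `T` the lost components and the
printed `u`, `ord_{≠ j}(shear_b(∂_{y_i^{p^ℓ}} In F)) ≥ u` for all `i ∈ T`. (Only the clauses `ℓ < e` and
"every exponent divisible by `p^ℓ`" of the level are used; maximality is not needed for (8).)
[cite: HauserPerlega2019PRIMS, §3 Theorem (8)] -/
theorem logHasseOrderCondition_literal_of_isPthPowerLevel {L : Type*} [Field L] [Fintype σ]
    [DecidableEq σ] [DecidableEq L] (p : ℕ) [hp : Fact p.Prime] [CharP L p] {e ℓ : ℕ} (j : σ)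
    (b : σ → L) (hbj : b j = 0) (s : PointBlowup.State σ L) {o : ℕ} (ho : ordZero s.F = o)
    (hqo : p ^ e ≤ o) (hr : ∀ d ∈ s.F.support, s.r ≤ d) (hinc : PointBlowup.ShadeIncreases (p ^ e) j b s)
    (hlev : IsPthPowerLevel p e ℓ (initialForm s.F)) :
    LogHasseOrderCondition p ℓ j b (PointBlowup.lostComponents j b)
      (literalResidualDegree (PointBlowup.lostComponents j b) (initialForm s.F)) (initialForm s.F) :=
  logHasseOrderCondition_literal_of_shadeIncreases p hlev.1 j b hbj s ho hqo hr hinc hlev.2.1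

/-- **The sharp bound (9) and the shape (8) use the same `ℓ`.** For the record: at the `p`-th power
level `ℓ` of the initial form the tree's `PointBlowup.shade_step_le_add_pow` gives the `p^ℓ`-form of (9)
(`SharpJumpBound p ℓ e j b s`: `shade' ≤ shade + p^ℓ`) under the same hypotheses, so after an increase
BOTH (8) (above) and `shade' ≤ shade + p^ℓ ≤ shade + p^{e−1}` hold with this `ℓ`.
[cite: HauserPerlega2019PRIMS, §3 Theorem (8), (9); §5 proof p. 12] -/
theorem sharpJumpBound_of_isPthPowerLevel {L : Type*} [Field L] [Fintype σ] [DecidableEq σ]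
    [DecidableEq L] (p : ℕ) [hp : Fact p.Prime] [CharP L p] {e ℓ : ℕ} (j : σ) (b : σ → L)
    (hbj : b j = 0) (s : PointBlowup.State σ L) {o : ℕ} (ho : ordZero s.F = o) (hqo : p ^ e ≤ o)
    (hr : ∀ d ∈ s.F.support, s.r ≤ d) (hlev : IsPthPowerLevel p e ℓ (initialForm s.F)) :
    SharpJumpBound p ℓ e j b s := by
  classical
  obtain ⟨hℓ, -, hnot⟩ := hlev
  unfold SharpJumpBound
  -- a monomial of the initial form with an exponent not divisible by `p^{ℓ+1}`
  push Not at hnot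
  obtain ⟨d₀, hd₀, i, hi⟩ := hnot
  unfold initialForm at hd₀
  rw [ho, ENat.toNat_coe, mem_support_iff, coeff_homogeneousComponent] at hd₀
  by_cases h : d₀.degree = o
  · rw [if_pos h] at hd₀
    exact PointBlowup.shade_step_le_add_pow p hℓ j b hbj s ho hqo hr
      ⟨d₀, mem_support_iff.mpr hd₀, h, i, hi⟩
  · exact absurd (if_neg h) hd₀

end HauserPerlega2019

end Literature.AlgebraicGeometry.Resolution
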